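import Summits.CriticalPhenomena.PercolationContinuityZ3.Theorems.PercNearOneGluingNoHeavyLowerTailQuantitativeSeparatorIdentities
import HarnessLib

/-!
# The separator class with a SIDE vertex pinned: the first-order bracket is non-negative (`c ≤ 0`) — PROOFS §P65 (a), BENCH row M2-R85

Support file (`--supports stmt-CriticalPhenomena-4575 --as helper`), prover seat `prim-rate-mine-2` (lane prim-rate, constants-miner (c);
`run/shared/lean/prim/prim-rate/prim-rate-mine-2/PROOFS.md` §P65 (a); BENCH row M2-R85 (gen 23)).
No definitions, no named facts, no sorries; standard axioms.

SETTING (the SEPARATOR CLASS, exactly as in `…QuantitativeSeparatorMoments` / `…QuantitativeSeparatorIdentities`).  Independent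
bond percolation with pair weights `w` on a finite vertex type `V`; vertices `x ≠ a`, a set `L` of vertices with `x, a ∉ L`, `b ∈ L`,
`u ∉ L`, and no positive weight across `{x,a}` (every pair on neither side has weight `0`).  Events `T = {x↔a}`, `F = {x↔b}`,
`G = {x↔u}`.  The size-law bracket of BENCH l.191 with the vertex `z ∈ {a,b,u}` PINNED is
`M_z := μ(TFG) + μ(Z)·μ(Z'∩Z'') − μ(Z')·μ(Z∩Z'') − μ(Z'')·μ(Z∩Z')` (`Z` the event of `z`, `Z', Z''` the other two); the first-order
constant of the vdBHK one-pair expansion with `z` pinned and the other two vertices observed is `c_z = −M_z / Cov(Z',Z'')`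
(`CSH.covD_onePair_eq`).  `M_a` (the separating vertex pinned) is the bracket of the separator size law `CSH.sep_sizeLaw`
(`c_a ≤ ⌊(n−2)²/4⌋/(n−2) − 1`, sharp on the hub–path towers).  THIS FILE: the two SIDE vertices.

* `CSH.sep_bracket_pinU_nonneg` — **`M_u = μ(TFG) + μ(G)μ(T∩F) − μ(F)μ(T∩G) − μ(T)μ(F∩G) ≥ 0`**: with the `R`-side vertex `u` pinned
  and `(a, b)` observed the first-order constant is `≤ 0` — i.e. `c ≤ 0` for EVERY weighted graph in which the pinned vertex is
  separated from one observed vertex by the root and the other observed vertex («dangling pin»; e.g. hub–path graphs with the pinned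
  vertex OUTSIDE the stretch between the two observed ones).  Complements the separator size law (pinned vertex BETWEEN) and is the
  second base case of the coordinate-concavity induction on hub + cycle graphs (PROOFS §P65 (b)).
* `CSH.sep_bracket_pinB_nonneg` — the mirror statement with the `L`-side vertex `b` pinned: `M_b ≥ 0`.
* (appended) `CSH.sep_bracket_pinU_eq_sum`, `CSH.sep_bracket_pinB_eq_sum` — the brackets as explicit four-term sums of non-negative
  products in the side atoms (equality locus).
PROOF.  In the side atoms of `…QuantitativeSeparatorMoments` (`α = μ(x↔_L a)`, `ξ = μ(x↔_L b)`, `κ = μ(x↔_L a ∧ x↔_L b)`,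
`λ_L = μ(a↔_L b ∧ x↮_L b)` and the `R`-side `α', ξ', κ', λ_R`) the seven moments are polynomials (`CSH.sep_real_T … sep_real_TFG`), and
`M_u = (κ − αξ)·[(1−α')(λ_R + 2ξ') − (κ' − α'ξ')] + λ_L(1−α)·[(1−α')(κ' − α'ξ') + α'(2ξ'(1−α') − (κ' − α'ξ'))]` (`ring`); every factor is
non-negative by Harris inside each side (`κ ≥ αξ`, `κ' ≥ α'ξ'`) and `κ' ≤ ξ'`.  Symmetrically for `M_b`.
[cite: VandenbergHaggstromKahn2005, Thm. 1.3 (p. 6)] [cite: Harris1960, Lemma 4.1 (p. 16)]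
-/

noncomputable section

namespace Summit.CriticalPhenomena.PercolationContinuityZ3.Theorems.CSH

open MeasureTheory Set unitInterval
open Literature.Probability.LatticeModels (prodBernoulli prodBernoulli_harris)
open Literature.Probability.Percolation
open Literature.Probability.Percolation.KNSep
open scoped Classical

variable {V : Type*}

section PinnedSide

variable [Fintype V]
variable (w : Sym2 V → unitInterval) (L : Set V) (x a b u : V)

/-- Pure algebra behind `CSH.sep_bracket_pinU_nonneg`: the bracket `M_u` written in the eight side atoms is non-negative under the
three Harris/monotonicity constraints. [folklore] -/
theorem sep_bracket_pinU_alg (α α' ξ ξ' κ κ' lL lR : ℝ)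
    (hα1 : α ≤ 1) (hα'0 : 0 ≤ α') (hα'1 : α' ≤ 1) (hlL : 0 ≤ lL) (hlR : 0 ≤ lR)
    (hκ : α * ξ ≤ κ) (hκ' : α' * ξ' ≤ κ') (hκ'le : κ' ≤ ξ') :
    0 ≤ (κ * ξ' + ξ * κ' - κ * κ' + κ * lR + lL * κ')
        + (ξ' + α * lR) * (κ + ξ * α' - κ * α' + lL * α')
        - (ξ + lL * α') * (κ' + α * ξ' - α * κ' + α * lR)
        - (α + α' - α * α') * (ξ * ξ' + κ * lR + lL * κ') := by
  have key : (κ * ξ' + ξ * κ' - κ * κ' + κ * lR + lL * κ')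
        + (ξ' + α * lR) * (κ + ξ * α' - κ * α' + lL * α')
        - (ξ + lL * α') * (κ' + α * ξ' - α * κ' + α * lR)
        - (α + α' - α * α') * (ξ * ξ' + κ * lR + lL * κ')
      = (κ - α * ξ) * ((1 - α') * (lR + 2 * ξ') - (κ' - α' * ξ'))
        + lL * (1 - α) * ((1 - α') * (κ' - α' * ξ') + α' * (2 * (ξ' * (1 - α')) - (κ' - α' * ξ'))) := by ring
  rw [key]
  have h1 : 0 ≤ κ - α * ξ := by linarith
  have h2 : 0 ≤ (1 - α') * (lR + 2 * ξ') - (κ' - α' * ξ') := by nlinarith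
  have h3 : 0 ≤ lL * (1 - α) := mul_nonneg hlL (by linarith)
  have h4 : 0 ≤ (1 - α') * (κ' - α' * ξ') := mul_nonneg (by linarith) (by linarith)
  have h5 : 0 ≤ α' * (2 * (ξ' * (1 - α')) - (κ' - α' * ξ')) := mul_nonneg hα'0 (by nlinarith)
  exact add_nonneg (mul_nonneg h1 h2) (mul_nonneg h3 (add_nonneg h4 h5))

/-- Pure algebra behind `CSH.sep_bracket_pinB_nonneg` (the mirror image of `sep_bracket_pinU_alg`). [folklore] -/
theorem sep_bracket_pinB_alg (α α' ξ ξ' κ κ' lL lR : ℝ)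
    (hα0 : 0 ≤ α) (hα1 : α ≤ 1) (hα'1 : α' ≤ 1) (hlL : 0 ≤ lL) (hlR : 0 ≤ lR)
    (hκ : α * ξ ≤ κ) (hκ' : α' * ξ' ≤ κ') (hκle : κ ≤ ξ) :
    0 ≤ (κ * ξ' + ξ * κ' - κ * κ' + κ * lR + lL * κ')
        + (ξ + lL * α') * (κ' + α * ξ' - α * κ' + α * lR)
        - (α + α' - α * α') * (ξ * ξ' + κ * lR + lL * κ')
        - (ξ' + α * lR) * (κ + ξ * α' - κ * α' + lL * α') := by
  have key : (κ * ξ' + ξ * κ' - κ * κ' + κ * lR + lL * κ')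
        + (ξ + lL * α') * (κ' + α * ξ' - α * κ' + α * lR)
        - (α + α' - α * α') * (ξ * ξ' + κ * lR + lL * κ')
        - (ξ' + α * lR) * (κ + ξ * α' - κ * α' + lL * α')
      = (κ' - α' * ξ') * ((1 - α) * (lL + 2 * ξ) - (κ - α * ξ))
        + lR * (1 - α') * ((1 - α) * (κ - α * ξ) + α * (2 * (ξ * (1 - α)) - (κ - α * ξ))) := by ring
  rw [key]
  have h1 : 0 ≤ κ' - α' * ξ' := by linarith
  have h2 : 0 ≤ (1 - α) * (lL + 2 * ξ) - (κ - α * ξ) := by nlinarith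
  have h3 : 0 ≤ lR * (1 - α') := mul_nonneg hlR (by linarith)
  have h4 : 0 ≤ (1 - α) * (κ - α * ξ) := mul_nonneg (by linarith) (by linarith)
  have h5 : 0 ≤ α * (2 * (ξ * (1 - α)) - (κ - α * ξ)) := mul_nonneg hα0 (by nlinarith)
  exact add_nonneg (mul_nonneg h1 h2) (mul_nonneg h3 (add_nonneg h4 h5))

variable {L x a b u}
variable (hx : x ∉ L) (ha : a ∉ L) (hxa : x ≠ a) (hb : b ∈ L) (hu : u ∉ L)
  (hcut : ∀ e, e ∉ sideB L ({x, a} : Set V) → e ∉ sideT L ({x, a} : Set V) → w e = 0)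
include hx ha hxa hb hu hcut

/-- **THE SIDE-PINNED BRACKET IS NON-NEGATIVE (`R`-side)** (PROOFS §P65 (a); BENCH M2-R85).  On the separator class (`{x,a}` separates
`b ∈ L` from `u ∉ L`), `μ(TFG) + μ(G)·μ(T∩F) − μ(F)·μ(T∩G) − μ(T)·μ(F∩G) ≥ 0` for `T = {x↔a}`, `F = {x↔b}`, `G = {x↔u}`: the
first-order constant of the one-pair vdBHK expansion with `u` pinned and `a, b` observed is `≤ 0` («dangling pin»).
[cite: VandenbergHaggstromKahn2005, Thm. 1.3 (p. 6)] [cite: Harris1960, Lemma 4.1 (p. 16)] -/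
theorem sep_bracket_pinU_nonneg :
    0 ≤ (prodBernoulli w).real (openConn x a ∩ openConn x b ∩ openConn x u) +
        (prodBernoulli w).real (openConn x u) * (prodBernoulli w).real (openConn x a ∩ openConn x b) -
        (prodBernoulli w).real (openConn x b) * (prodBernoulli w).real (openConn x a ∩ openConn x u) -
        (prodBernoulli w).real (openConn x a) * (prodBernoulli w).real (openConn x b ∩ openConn x u) := by
  have hmonoL : ∀ (p q : V), IsUpperSet ({ω : BondConfig V | rB L {x, a} ω p q} : Set (BondConfig V)) :=
    fun p q ω ω' hle h => SimpleGraph.Reachable.mono (openGraph_mono (Set.inter_subset_inter_left _ hle)) h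
  have hmonoR : ∀ (p q : V),
      IsUpperSet ({ω : BondConfig V | (openGraph (ω ∩ sideT L {x, a})).Reachable p q} : Set (BondConfig V)) :=
    fun p q ω ω' hle h => SimpleGraph.Reachable.mono (openGraph_mono (Set.inter_subset_inter_left _ hle)) h
  have hHL := prodBernoulli_harris w (hmonoL x a) (hmonoL x b) MeasurableSet.of_discrete MeasurableSet.of_discrete
  have hHR := prodBernoulli_harris w (hmonoR x a) (hmonoR x u) MeasurableSet.of_discrete MeasurableSet.of_discrete
  have hκ'le : (prodBernoulli w).real ((({ω : BondConfig V | (openGraph (ω ∩ sideT L {x, a})).Reachable x a} : Set (BondConfig V))) ∩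
        (({ω : BondConfig V | (openGraph (ω ∩ sideT L {x, a})).Reachable x u} : Set (BondConfig V)))) ≤
      (prodBernoulli w).real (({ω : BondConfig V | (openGraph (ω ∩ sideT L {x, a})).Reachable x u} : Set (BondConfig V))) :=
    measureReal_mono Set.inter_subset_right
  have hα1 : (prodBernoulli w).real (({ω : BondConfig V | rB L {x, a} ω x a} : Set (BondConfig V))) ≤ 1 :=
    measureReal_le_one
  have hα'0 : 0 ≤ (prodBernoulli w).real (({ω : BondConfig V | (openGraph (ω ∩ sideT L {x, a})).Reachable x a} : Set (BondConfig V))) :=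
    measureReal_nonneg
  have hα'1 : (prodBernoulli w).real (({ω : BondConfig V | (openGraph (ω ∩ sideT L {x, a})).Reachable x a} : Set (BondConfig V))) ≤ 1 :=
    measureReal_le_one
  have hlL : 0 ≤ (prodBernoulli w).real ((({ω : BondConfig V | rB L {x, a} ω a b} : Set (BondConfig V)) ∩
        ({ω : BondConfig V | rB L {x, a} ω x b} : Set (BondConfig V))ᶜ)) := measureReal_nonneg
  have hlR : 0 ≤ (prodBernoulli w).real ((({ω : BondConfig V | (openGraph (ω ∩ sideT L {x, a})).Reachable a u} : Set (BondConfig V)) ∩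
        ({ω : BondConfig V | (openGraph (ω ∩ sideT L {x, a})).Reachable x u} : Set (BondConfig V))ᶜ)) := measureReal_nonneg
  have halg := sep_bracket_pinU_alg
    ((prodBernoulli w).real (({ω : BondConfig V | rB L {x, a} ω x a} : Set (BondConfig V))))
    ((prodBernoulli w).real (({ω : BondConfig V | (openGraph (ω ∩ sideT L {x, a})).Reachable x a} : Set (BondConfig V))))
    ((prodBernoulli w).real (({ω : BondConfig V | rB L {x, a} ω x b} : Set (BondConfig V))))
    ((prodBernoulli w).real (({ω : BondConfig V | (openGraph (ω ∩ sideT L {x, a})).Reachable x u} : Set (BondConfig V))))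
    ((prodBernoulli w).real ((({ω : BondConfig V | rB L {x, a} ω x a} : Set (BondConfig V))) ∩
        (({ω : BondConfig V | rB L {x, a} ω x b} : Set (BondConfig V)))))
    ((prodBernoulli w).real ((({ω : BondConfig V | (openGraph (ω ∩ sideT L {x, a})).Reachable x a} : Set (BondConfig V))) ∩
        (({ω : BondConfig V | (openGraph (ω ∩ sideT L {x, a})).Reachable x u} : Set (BondConfig V)))))
    ((prodBernoulli w).real ((({ω : BondConfig V | rB L {x, a} ω a b} : Set (BondConfig V)) ∩
        ({ω : BondConfig V | rB L {x, a} ω x b} : Set (BondConfig V))ᶜ)))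
    ((prodBernoulli w).real ((({ω : BondConfig V | (openGraph (ω ∩ sideT L {x, a})).Reachable a u} : Set (BondConfig V)) ∩
        ({ω : BondConfig V | (openGraph (ω ∩ sideT L {x, a})).Reachable x u} : Set (BondConfig V))ᶜ)))
    hα1 hα'0 hα'1 hlL hlR (by linarith [hHL]) (by linarith [hHR]) hκ'le
  rw [sep_real_TFG w hx ha hxa hb hu hcut, sep_real_TF w hx ha hxa hb hu hcut, sep_real_TG w hx ha hxa hb hu hcut,
    sep_real_FG w hx ha hxa hb hu hcut, sep_real_T w hx ha hxa hb hu hcut, sep_real_F w hx ha hxa hb hu hcut,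
    sep_real_G w hx ha hxa hb hu hcut]
  linarith [halg]

/-- **THE SIDE-PINNED BRACKET IS NON-NEGATIVE (`L`-side)** (PROOFS §P65 (a); BENCH M2-R85): on the separator class,
`μ(TFG) + μ(F)·μ(T∩G) − μ(T)·μ(F∩G) − μ(G)·μ(T∩F) ≥ 0` — the first-order constant with `b` pinned and `a, u` observed is `≤ 0`.
[cite: VandenbergHaggstromKahn2005, Thm. 1.3 (p. 6)] [cite: Harris1960, Lemma 4.1 (p. 16)] -/
theorem sep_bracket_pinB_nonneg :
    0 ≤ (prodBernoulli w).real (openConn x a ∩ openConn x b ∩ openConn x u) +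
        (prodBernoulli w).real (openConn x b) * (prodBernoulli w).real (openConn x a ∩ openConn x u) -
        (prodBernoulli w).real (openConn x a) * (prodBernoulli w).real (openConn x b ∩ openConn x u) -
        (prodBernoulli w).real (openConn x u) * (prodBernoulli w).real (openConn x a ∩ openConn x b) := by
  have hmonoL : ∀ (p q : V), IsUpperSet ({ω : BondConfig V | rB L {x, a} ω p q} : Set (BondConfig V)) :=
    fun p q ω ω' hle h => SimpleGraph.Reachable.mono (openGraph_mono (Set.inter_subset_inter_left _ hle)) h
  have hmonoR : ∀ (p q : V),
      IsUpperSet ({ω : BondConfig V | (openGraph (ω ∩ sideT L {x, a})).Reachable p q} : Set (BondConfig V)) :=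
    fun p q ω ω' hle h => SimpleGraph.Reachable.mono (openGraph_mono (Set.inter_subset_inter_left _ hle)) h
  have hHL := prodBernoulli_harris w (hmonoL x a) (hmonoL x b) MeasurableSet.of_discrete MeasurableSet.of_discrete
  have hHR := prodBernoulli_harris w (hmonoR x a) (hmonoR x u) MeasurableSet.of_discrete MeasurableSet.of_discrete
  have hκle : (prodBernoulli w).real ((({ω : BondConfig V | rB L {x, a} ω x a} : Set (BondConfig V))) ∩
        (({ω : BondConfig V | rB L {x, a} ω x b} : Set (BondConfig V)))) ≤
      (prodBernoulli w).real (({ω : BondConfig V | rB L {x, a} ω x b} : Set (BondConfig V))) :=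
    measureReal_mono Set.inter_subset_right
  have hα0 : 0 ≤ (prodBernoulli w).real (({ω : BondConfig V | rB L {x, a} ω x a} : Set (BondConfig V))) := measureReal_nonneg
  have hα1 : (prodBernoulli w).real (({ω : BondConfig V | rB L {x, a} ω x a} : Set (BondConfig V))) ≤ 1 := measureReal_le_one
  have hα'1 : (prodBernoulli w).real (({ω : BondConfig V | (openGraph (ω ∩ sideT L {x, a})).Reachable x a} : Set (BondConfig V))) ≤ 1 :=
    measureReal_le_one
  have hlL : 0 ≤ (prodBernoulli w).real ((({ω : BondConfig V | rB L {x, a} ω a b} : Set (BondConfig V)) ∩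
        ({ω : BondConfig V | rB L {x, a} ω x b} : Set (BondConfig V))ᶜ)) := measureReal_nonneg
  have hlR : 0 ≤ (prodBernoulli w).real ((({ω : BondConfig V | (openGraph (ω ∩ sideT L {x, a})).Reachable a u} : Set (BondConfig V)) ∩
        ({ω : BondConfig V | (openGraph (ω ∩ sideT L {x, a})).Reachable x u} : Set (BondConfig V))ᶜ)) := measureReal_nonneg
  have halg := sep_bracket_pinB_alg
    ((prodBernoulli w).real (({ω : BondConfig V | rB L {x, a} ω x a} : Set (BondConfig V))))
    ((prodBernoulli w).real (({ω : BondConfig V | (openGraph (ω ∩ sideT L {x, a})).Reachable x a} : Set (BondConfig V))))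
    ((prodBernoulli w).real (({ω : BondConfig V | rB L {x, a} ω x b} : Set (BondConfig V))))
    ((prodBernoulli w).real (({ω : BondConfig V | (openGraph (ω ∩ sideT L {x, a})).Reachable x u} : Set (BondConfig V))))
    ((prodBernoulli w).real ((({ω : BondConfig V | rB L {x, a} ω x a} : Set (BondConfig V))) ∩
        (({ω : BondConfig V | rB L {x, a} ω x b} : Set (BondConfig V)))))
    ((prodBernoulli w).real ((({ω : BondConfig V | (openGraph (ω ∩ sideT L {x, a})).Reachable x a} : Set (BondConfig V))) ∩
        (({ω : BondConfig V | (openGraph (ω ∩ sideT L {x, a})).Reachable x u} : Set (BondConfig V)))))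
    ((prodBernoulli w).real ((({ω : BondConfig V | rB L {x, a} ω a b} : Set (BondConfig V)) ∩
        ({ω : BondConfig V | rB L {x, a} ω x b} : Set (BondConfig V))ᶜ)))
    ((prodBernoulli w).real ((({ω : BondConfig V | (openGraph (ω ∩ sideT L {x, a})).Reachable a u} : Set (BondConfig V)) ∩
        ({ω : BondConfig V | (openGraph (ω ∩ sideT L {x, a})).Reachable x u} : Set (BondConfig V))ᶜ)))
    hα0 hα1 hα'1 hlL hlR (by linarith [hHL]) (by linarith [hHR]) hκle
  rw [sep_real_TFG w hx ha hxa hb hu hcut, sep_real_TF w hx ha hxa hb hu hcut, sep_real_TG w hx ha hxa hb hu hcut,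
    sep_real_FG w hx ha hxa hb hu hcut, sep_real_T w hx ha hxa hb hu hcut, sep_real_F w hx ha hxa hb hu hcut,
    sep_real_G w hx ha hxa hb hu hcut]
  linarith [halg]

/-! ### Appended (gen 23, PROOFS §P65 (a′)): the side-pinned brackets as MANIFESTLY NON-NEGATIVE four-term sums (equality locus) -/

/-- **EXACT POSITIVE DECOMPOSITION of `M_u`** (PROOFS §P65 (a′); BENCH M2-R85 addendum).  In the side atoms
(`α = μ(x↔_L a)`, `ξ = μ(x↔_L b)`, `κ = μ(x↔_L a ∧ x↔_L b)`, `λ_L = μ(a↔_L b ∧ x↮_L b)`, and `α′, ξ′, κ′, λ_R` on the `R`-side):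
`M_u = (1−α′)·[(κ−αξ)(λ_R+ξ′) + λ_L(1−α)κ′] + (ξ′−κ′)·[(κ−αξ) + α′λ_L(1−α)]` — four products of non-negative reals
(Harris inside the `L`-side: `κ ≥ αξ`; `κ′ ≤ ξ′`), so `M_u = 0` forces each of them to vanish (equality locus of the dangling-pin
size law). [cite: VandenbergHaggstromKahn2005, Thm. 1.3 (p. 6)] [cite: Harris1960, Lemma 4.1 (p. 16)] -/
theorem sep_bracket_pinU_eq_sum :
    (prodBernoulli w).real (openConn x a ∩ openConn x b ∩ openConn x u) +
        (prodBernoulli w).real (openConn x u) * (prodBernoulli w).real (openConn x a ∩ openConn x b) -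
        (prodBernoulli w).real (openConn x b) * (prodBernoulli w).real (openConn x a ∩ openConn x u) -
        (prodBernoulli w).real (openConn x a) * (prodBernoulli w).real (openConn x b ∩ openConn x u) =
      (1 - (prodBernoulli w).real (({ω : BondConfig V | (openGraph (ω ∩ sideT L {x, a})).Reachable x a} : Set (BondConfig V)))) *
          (((prodBernoulli w).real ((({ω : BondConfig V | rB L {x, a} ω x a} : Set (BondConfig V))) ∩
        (({ω : BondConfig V | rB L {x, a} ω x b} : Set (BondConfig V)))) - (prodBernoulli w).real (({ω : BondConfig V | rB L {x, a} ω x a} : Set (BondConfig V))) * (prodBernoulli w).real (({ω : BondConfig V | rB L {x, a} ω x b} : Set (BondConfig V)))) * ((prodBernoulli w).real ((({ω : BondConfig V | (openGraph (ω ∩ sideT L {x, a})).Reachable a u} : Set (BondConfig V)) ∩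
        ({ω : BondConfig V | (openGraph (ω ∩ sideT L {x, a})).Reachable x u} : Set (BondConfig V))ᶜ)) + (prodBernoulli w).real (({ω : BondConfig V | (openGraph (ω ∩ sideT L {x, a})).Reachable x u} : Set (BondConfig V)))) +
            (prodBernoulli w).real ((({ω : BondConfig V | rB L {x, a} ω a b} : Set (BondConfig V)) ∩
        ({ω : BondConfig V | rB L {x, a} ω x b} : Set (BondConfig V))ᶜ)) * (1 - (prodBernoulli w).real (({ω : BondConfig V | rB L {x, a} ω x a} : Set (BondConfig V)))) * (prodBernoulli w).real ((({ω : BondConfig V | (openGraph (ω ∩ sideT L {x, a})).Reachable x a} : Set (BondConfig V))) ∩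
        (({ω : BondConfig V | (openGraph (ω ∩ sideT L {x, a})).Reachable x u} : Set (BondConfig V))))) +
        ((prodBernoulli w).real (({ω : BondConfig V | (openGraph (ω ∩ sideT L {x, a})).Reachable x u} : Set (BondConfig V))) - (prodBernoulli w).real ((({ω : BondConfig V | (openGraph (ω ∩ sideT L {x, a})).Reachable x a} : Set (BondConfig V))) ∩
        (({ω : BondConfig V | (openGraph (ω ∩ sideT L {x, a})).Reachable x u} : Set (BondConfig V))))) *
          (((prodBernoulli w).real ((({ω : BondConfig V | rB L {x, a} ω x a} : Set (BondConfig V))) ∩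
        (({ω : BondConfig V | rB L {x, a} ω x b} : Set (BondConfig V)))) - (prodBernoulli w).real (({ω : BondConfig V | rB L {x, a} ω x a} : Set (BondConfig V))) * (prodBernoulli w).real (({ω : BondConfig V | rB L {x, a} ω x b} : Set (BondConfig V)))) + (prodBernoulli w).real (({ω : BondConfig V | (openGraph (ω ∩ sideT L {x, a})).Reachable x a} : Set (BondConfig V))) * (prodBernoulli w).real ((({ω : BondConfig V | rB L {x, a} ω a b} : Set (BondConfig V)) ∩
        ({ω : BondConfig V | rB L {x, a} ω x b} : Set (BondConfig V))ᶜ)) * (1 - (prodBernoulli w).real (({ω : BondConfig V | rB L {x, a} ω x a} : Set (BondConfig V))))) := by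
  rw [sep_real_TFG w hx ha hxa hb hu hcut, sep_real_TF w hx ha hxa hb hu hcut, sep_real_TG w hx ha hxa hb hu hcut,
    sep_real_FG w hx ha hxa hb hu hcut, sep_real_T w hx ha hxa hb hu hcut, sep_real_F w hx ha hxa hb hu hcut,
    sep_real_G w hx ha hxa hb hu hcut]
  ring

/-- **EXACT POSITIVE DECOMPOSITION of `M_b`** (mirror image of `sep_bracket_pinU_eq_sum`):
`M_b = (1−α)·[(κ′−α′ξ′)(λ_L+ξ) + λ_R(1−α′)κ] + (ξ−κ)·[(κ′−α′ξ′) + αλ_R(1−α′)]`.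
[cite: VandenbergHaggstromKahn2005, Thm. 1.3 (p. 6)] [cite: Harris1960, Lemma 4.1 (p. 16)] -/
theorem sep_bracket_pinB_eq_sum :
    (prodBernoulli w).real (openConn x a ∩ openConn x b ∩ openConn x u) +
        (prodBernoulli w).real (openConn x b) * (prodBernoulli w).real (openConn x a ∩ openConn x u) -
        (prodBernoulli w).real (openConn x a) * (prodBernoulli w).real (openConn x b ∩ openConn x u) -
        (prodBernoulli w).real (openConn x u) * (prodBernoulli w).real (openConn x a ∩ openConn x b) =
      (1 - (prodBernoulli w).real (({ω : BondConfig V | rB L {x, a} ω x a} : Set (BondConfig V)))) *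
          (((prodBernoulli w).real ((({ω : BondConfig V | (openGraph (ω ∩ sideT L {x, a})).Reachable x a} : Set (BondConfig V))) ∩
        (({ω : BondConfig V | (openGraph (ω ∩ sideT L {x, a})).Reachable x u} : Set (BondConfig V)))) - (prodBernoulli w).real (({ω : BondConfig V | (openGraph (ω ∩ sideT L {x, a})).Reachable x a} : Set (BondConfig V))) * (prodBernoulli w).real (({ω : BondConfig V | (openGraph (ω ∩ sideT L {x, a})).Reachable x u} : Set (BondConfig V)))) * ((prodBernoulli w).real ((({ω : BondConfig V | rB L {x, a} ω a b} : Set (BondConfig V)) ∩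
        ({ω : BondConfig V | rB L {x, a} ω x b} : Set (BondConfig V))ᶜ)) + (prodBernoulli w).real (({ω : BondConfig V | rB L {x, a} ω x b} : Set (BondConfig V)))) +
            (prodBernoulli w).real ((({ω : BondConfig V | (openGraph (ω ∩ sideT L {x, a})).Reachable a u} : Set (BondConfig V)) ∩
        ({ω : BondConfig V | (openGraph (ω ∩ sideT L {x, a})).Reachable x u} : Set (BondConfig V))ᶜ)) * (1 - (prodBernoulli w).real (({ω : BondConfig V | (openGraph (ω ∩ sideT L {x, a})).Reachable x a} : Set (BondConfig V)))) * (prodBernoulli w).real ((({ω : BondConfig V | rB L {x, a} ω x a} : Set (BondConfig V))) ∩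
        (({ω : BondConfig V | rB L {x, a} ω x b} : Set (BondConfig V))))) +
        ((prodBernoulli w).real (({ω : BondConfig V | rB L {x, a} ω x b} : Set (BondConfig V))) - (prodBernoulli w).real ((({ω : BondConfig V | rB L {x, a} ω x a} : Set (BondConfig V))) ∩
        (({ω : BondConfig V | rB L {x, a} ω x b} : Set (BondConfig V))))) *
          (((prodBernoulli w).real ((({ω : BondConfig V | (openGraph (ω ∩ sideT L {x, a})).Reachable x a} : Set (BondConfig V))) ∩
        (({ω : BondConfig V | (openGraph (ω ∩ sideT L {x, a})).Reachable x u} : Set (BondConfig V)))) - (prodBernoulli w).real (({ω : BondConfig V | (openGraph (ω ∩ sideT L {x, a})).Reachable x a} : Set (BondConfig V))) * (prodBernoulli w).real (({ω : BondConfig V | (openGraph (ω ∩ sideT L {x, a})).Reachable x u} : Set (BondConfig V)))) + (prodBernoulli w).real (({ω : BondConfig V | rB L {x, a} ω x a} : Set (BondConfig V))) * (prodBernoulli w).real ((({ω : BondConfig V | (openGraph (ω ∩ sideT L {x, a})).Reachable a u} : Set (BondConfig V)) ∩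
        ({ω : BondConfig V | (openGraph (ω ∩ sideT L {x, a})).Reachable x u} : Set (BondConfig V))ᶜ)) * (1 - (prodBernoulli w).real (({ω : BondConfig V | (openGraph (ω ∩ sideT L {x, a})).Reachable x a} : Set (BondConfig V))))) := by
  rw [sep_real_TFG w hx ha hxa hb hu hcut, sep_real_TF w hx ha hxa hb hu hcut, sep_real_TG w hx ha hxa hb hu hcut,
    sep_real_FG w hx ha hxa hb hu hcut, sep_real_T w hx ha hxa hb hu hcut, sep_real_F w hx ha hxa hb hu hcut,
    sep_real_G w hx ha hxa hb hu hcut]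
  ring

end PinnedSide

end Summit.CriticalPhenomena.PercolationContinuityZ3.Theorems.CSH
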